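import Mathlib
import Summits.MatrixMultiplication.MatrixMultiplication.Theses.HessianPlane
import Literature.Computability.AlgebraicComplexity.TensorRestrictionRank
import Literature.Computability.AlgebraicComplexity.GroupAlgebraTensor

/-!
# Route HessianPlane — support item `WeylSymmetry` (stmt-MatrixMultiplication-4896): proved

For `ω² + ω + 1 = 0` the Hessian-plane tensor
`u(a,b,c)(x,y,z) = [x + y + z ≡ 0] · (a,b,c)_{y-x}` on `(Fin 3)³` has the same tensor rank in every
Kronecker power as `u(b,c,a)`, `u(a,c,b)`, `u(a,ωb,ω²c)`, `u(a,ωb,ωc)` and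
`u(a+b+c, a+ω²b+ωc, a+ωb+ω²c)` (the generators `C, S, D, D′, F` of the Weyl group of Nurmiev's
Cartan subspace, Vinberg 1976 / Nurmiev 2000 / Bremner–Hu–Oeding 2014 §4).

## Proof

Each of the five parameter changes is realised by a pair of mutually inverse RESTRICTIONS
(`TensorRestrictsTo`, i.e. `(A ⊗ B ⊗ C)·u`) with explicit `3 × 3` matrices:

* `C` : the coordinate relabelling `y ↦ y + 1`, `z ↦ z − 1` (and `C³ = id`);
* `S` : negation `x, y, z ↦ −x, −y, −z` on all three factors (an involution; no factor swap is
  needed because `−(y − x)` exchanges the weights `b` and `c`);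
* `D` : the diagonal scalings `diag(1, ω², ω) ⊗ diag(1, ω, ω²) ⊗ 1`, inverse
  `diag(1, ω, ω²) ⊗ diag(1, ω², ω) ⊗ 1` (`ω³ = 1`);
* `D′`: `diag(1, ω, 1)` on all three factors, inverse `diag(1, ω², 1)` on all three;
* `F` : `(⅓·DFT) ⊗ DFT ⊗ DFT` with `DFT = (ω^{jk})`, inverse `(⅑·DFT') ⊗ DFT' ⊗ DFT'` with
  `DFT' = (ω^{-jk})` (`DFT'·DFT = 3·1`).

The matrix identities are finite checks on `27` entries (`fin_cases` + `simp` + `grind`, the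
latter doing the ring arithmetic modulo `ω² + ω + 1 = 0`, `3t = 1`, `9s = 1`). Restriction is
compatible with Kronecker powers (`TensorRestrictsTo.kroneckerPow`, BCS Rem. (14.28)) and rank is
monotone under restriction (`TensorRestrictsTo.tensorRank_le`, Bläser 2013 Lemma 5.4), so mutual
restriction of `u` and `u'` gives `R(u^{⊠N}) = R(u'^{⊠N})` for every `N`.

The tensor `u(a,b,c)` is written throughout as the literal lambda of the route file,
`fun x y z : Fin 3 => if x + y + z = 0 then ![a, b, c] (y - x) else (0 : ℂ)`.
-/

set_option linter.dupNamespace false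

noncomputable section

namespace Summit.MatrixMultiplication.MatrixMultiplication.Theorems

open scoped BigOperators
open Literature.Computability.AlgebraicComplexity

namespace HessianPlaneWeyl

/-- Mutual restriction of two tensors gives equal ranks of all their Kronecker powers
(restriction is compatible with `⊠` and rank is restriction-monotone). -/
theorem tensorRank_kroneckerPow_eq_of_restricts {s t : Fin 3 → Fin 3 → Fin 3 → ℂ}
    (hst : TensorRestrictsTo s t) (hts : TensorRestrictsTo t s) (N : ℕ) :
    tensorRank (kroneckerPow s N) = tensorRank (kroneckerPow t N) :=
  le_antisymm (hts.kroneckerPow N).tensorRank_le (hst.kroneckerPow N).tensorRank_le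

/-- Diagonal scaling of the three factors is a restriction (diagonal matrices). -/
theorem restrictsTo_diag {K : Type*} [CommSemiring K] {ι κ μ : Type*} [Fintype ι] [Fintype κ]
    [Fintype μ] [DecidableEq ι] [DecidableEq κ] [DecidableEq μ] (t : ι → κ → μ → K)
    (d₁ : ι → K) (d₂ : κ → K) (d₃ : μ → K) :
    TensorRestrictsTo t (fun x y z => d₁ x * d₂ y * d₃ z * t x y z) := by
  refine ⟨fun x' x => if x = x' then d₁ x else 0, fun y' y => if y = y' then d₂ y else 0,
    fun z' z => if z = z' then d₃ z else 0, fun x' y' z' => ?_⟩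
  rw [Finset.sum_eq_single x' (fun x _ hx => by simp [hx]) (by simp),
    Finset.sum_eq_single y' (fun y _ hy => by simp [hy]) (by simp),
    Finset.sum_eq_single z' (fun z _ hz => by simp [hz]) (by simp)]
  simp

/-! ### `C`: cyclic shift of the weights -/

/-- `u(b,c,a)(x,y,z) = u(a,b,c)(x, y+1, z-1)`. -/
theorem cyclic_eq (a b c : ℂ) :
    (fun x y z : Fin 3 => if x + y + z = 0 then ![b, c, a] (y - x) else (0 : ℂ)) =
      fun x y z => (fun x y z : Fin 3 => if x + y + z = 0 then ![a, b, c] (y - x) else (0 : ℂ))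
        x (y + 1) (z - 1) := by
  funext x y z
  fin_cases x <;> fin_cases y <;> fin_cases z <;> rfl

/-- `u(a,b,c) ≥ u(b,c,a)`. -/
theorem restricts_cyclic (a b c : ℂ) :
    TensorRestrictsTo
      (fun x y z : Fin 3 => if x + y + z = 0 then ![a, b, c] (y - x) else (0 : ℂ))
      (fun x y z : Fin 3 => if x + y + z = 0 then ![b, c, a] (y - x) else (0 : ℂ)) := by
  rw [cyclic_eq a b c]
  exact tensorRestrictsTo_precomp
    (fun x y z : Fin 3 => if x + y + z = 0 then ![a, b, c] (y - x) else (0 : ℂ))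
    (fun x : Fin 3 => x) (fun y : Fin 3 => y + 1) (fun z : Fin 3 => z - 1)

/-! ### `S`: exchanging the last two weights -/

/-- `u(a,c,b)(x,y,z) = u(a,b,c)(-x, -y, -z)`. -/
theorem swap_eq (a b c : ℂ) :
    (fun x y z : Fin 3 => if x + y + z = 0 then ![a, c, b] (y - x) else (0 : ℂ)) =
      fun x y z => (fun x y z : Fin 3 => if x + y + z = 0 then ![a, b, c] (y - x) else (0 : ℂ))
        (-x) (-y) (-z) := by
  funext x y z
  fin_cases x <;> fin_cases y <;> fin_cases z <;> rfl

/-- `u(a,b,c) ≥ u(a,c,b)`. -/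
theorem restricts_swap (a b c : ℂ) :
    TensorRestrictsTo
      (fun x y z : Fin 3 => if x + y + z = 0 then ![a, b, c] (y - x) else (0 : ℂ))
      (fun x y z : Fin 3 => if x + y + z = 0 then ![a, c, b] (y - x) else (0 : ℂ)) := by
  rw [swap_eq a b c]
  exact tensorRestrictsTo_precomp
    (fun x y z : Fin 3 => if x + y + z = 0 then ![a, b, c] (y - x) else (0 : ℂ))
    (fun x : Fin 3 => -x) (fun y : Fin 3 => -y) (fun z : Fin 3 => -z)

/-! ### `D`: the characters `diag(1, ω², ω) ⊗ diag(1, ω, ω²) ⊗ 1` -/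

/-- `u(a, ωb, ω²c) = (diag(1,ω²,ω) ⊗ diag(1,ω,ω²) ⊗ 1) · u(a,b,c)`. -/
theorem charD_eq (ω a b c : ℂ) (hω : ω ^ 2 + ω + 1 = 0) :
    (fun x y z : Fin 3 => if x + y + z = 0 then ![a, ω * b, ω ^ 2 * c] (y - x) else (0 : ℂ)) =
      fun x y z => ![1, ω ^ 2, ω] x * ![1, ω, ω ^ 2] y * ![1, 1, 1] z *
        (fun x y z : Fin 3 => if x + y + z = 0 then ![a, b, c] (y - x) else (0 : ℂ)) x y z := by
  funext x y z
  fin_cases x <;> fin_cases y <;> fin_cases z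
  all_goals simp (config := { decide := true })
  all_goals grind

/-- `u(a,b,c) = (diag(1,ω,ω²) ⊗ diag(1,ω²,ω) ⊗ 1) · u(a, ωb, ω²c)`. -/
theorem charD_inv_eq (ω a b c : ℂ) (hω : ω ^ 2 + ω + 1 = 0) :
    (fun x y z : Fin 3 => if x + y + z = 0 then ![a, b, c] (y - x) else (0 : ℂ)) =
      fun x y z => ![1, ω, ω ^ 2] x * ![1, ω ^ 2, ω] y * ![1, 1, 1] z *
        (fun x y z : Fin 3 => if x + y + z = 0 then ![a, ω * b, ω ^ 2 * c] (y - x) else (0 : ℂ))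
          x y z := by
  funext x y z
  fin_cases x <;> fin_cases y <;> fin_cases z
  all_goals simp (config := { decide := true })
  all_goals grind

/-- `u(a,b,c) ≥ u(a, ωb, ω²c)`. -/
theorem restricts_charD (ω a b c : ℂ) (hω : ω ^ 2 + ω + 1 = 0) :
    TensorRestrictsTo
      (fun x y z : Fin 3 => if x + y + z = 0 then ![a, b, c] (y - x) else (0 : ℂ))
      (fun x y z : Fin 3 =>
        if x + y + z = 0 then ![a, ω * b, ω ^ 2 * c] (y - x) else (0 : ℂ)) := by
  rw [charD_eq ω a b c hω]
  exact restrictsTo_diag _ _ _ _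

/-- `u(a, ωb, ω²c) ≥ u(a,b,c)`. -/
theorem restricts_charD_inv (ω a b c : ℂ) (hω : ω ^ 2 + ω + 1 = 0) :
    TensorRestrictsTo
      (fun x y z : Fin 3 =>
        if x + y + z = 0 then ![a, ω * b, ω ^ 2 * c] (y - x) else (0 : ℂ))
      (fun x y z : Fin 3 => if x + y + z = 0 then ![a, b, c] (y - x) else (0 : ℂ)) := by
  have h := restrictsTo_diag
    (fun x y z : Fin 3 => if x + y + z = 0 then ![a, ω * b, ω ^ 2 * c] (y - x) else (0 : ℂ))
    ![1, ω, ω ^ 2] ![1, ω ^ 2, ω] ![1, 1, 1]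
  rwa [← charD_inv_eq ω a b c hω] at h

/-! ### `D′`: `diag(1, ω, 1)` on all three factors -/

/-- `u(a, ωb, ωc) = diag(1,ω,1)^{⊗3} · u(a,b,c)`. -/
theorem charD'_eq (ω a b c : ℂ) (hω : ω ^ 2 + ω + 1 = 0) :
    (fun x y z : Fin 3 => if x + y + z = 0 then ![a, ω * b, ω * c] (y - x) else (0 : ℂ)) =
      fun x y z => ![1, ω, 1] x * ![1, ω, 1] y * ![1, ω, 1] z *
        (fun x y z : Fin 3 => if x + y + z = 0 then ![a, b, c] (y - x) else (0 : ℂ)) x y z := by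
  funext x y z
  fin_cases x <;> fin_cases y <;> fin_cases z
  all_goals simp (config := { decide := true })
  all_goals grind

/-- `u(a,b,c) = diag(1,ω²,1)^{⊗3} · u(a, ωb, ωc)`. -/
theorem charD'_inv_eq (ω a b c : ℂ) (hω : ω ^ 2 + ω + 1 = 0) :
    (fun x y z : Fin 3 => if x + y + z = 0 then ![a, b, c] (y - x) else (0 : ℂ)) =
      fun x y z => ![1, ω ^ 2, 1] x * ![1, ω ^ 2, 1] y * ![1, ω ^ 2, 1] z *
        (fun x y z : Fin 3 => if x + y + z = 0 then ![a, ω * b, ω * c] (y - x) else (0 : ℂ))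
          x y z := by
  funext x y z
  fin_cases x <;> fin_cases y <;> fin_cases z
  all_goals simp (config := { decide := true })
  all_goals grind

/-- `u(a,b,c) ≥ u(a, ωb, ωc)`. -/
theorem restricts_charD' (ω a b c : ℂ) (hω : ω ^ 2 + ω + 1 = 0) :
    TensorRestrictsTo
      (fun x y z : Fin 3 => if x + y + z = 0 then ![a, b, c] (y - x) else (0 : ℂ))
      (fun x y z : Fin 3 => if x + y + z = 0 then ![a, ω * b, ω * c] (y - x) else (0 : ℂ)) := by
  rw [charD'_eq ω a b c hω]
  exact restrictsTo_diag _ _ _ _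

/-- `u(a, ωb, ωc) ≥ u(a,b,c)`. -/
theorem restricts_charD'_inv (ω a b c : ℂ) (hω : ω ^ 2 + ω + 1 = 0) :
    TensorRestrictsTo
      (fun x y z : Fin 3 => if x + y + z = 0 then ![a, ω * b, ω * c] (y - x) else (0 : ℂ))
      (fun x y z : Fin 3 => if x + y + z = 0 then ![a, b, c] (y - x) else (0 : ℂ)) := by
  have h := restrictsTo_diag
    (fun x y z : Fin 3 => if x + y + z = 0 then ![a, ω * b, ω * c] (y - x) else (0 : ℂ))
    ![1, ω ^ 2, 1] ![1, ω ^ 2, 1] ![1, ω ^ 2, 1]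
  rwa [← charD'_inv_eq ω a b c hω] at h

/-! ### `F`: the Fourier element `(⅓·DFT) ⊗ DFT ⊗ DFT` -/

/-- `u(a,b,c) ≥ u(a+b+c, a+ω²b+ωc, a+ωb+ω²c)`: the matrices are `t·DFT, DFT, DFT` with
`DFT = (ω^{jk})` and `3t = 1`. -/
theorem restricts_fourier (ω a b c : ℂ) (hω : ω ^ 2 + ω + 1 = 0) :
    TensorRestrictsTo
      (fun x y z : Fin 3 => if x + y + z = 0 then ![a, b, c] (y - x) else (0 : ℂ))
      (fun x y z : Fin 3 =>
        if x + y + z = 0 then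
          ![a + b + c, a + ω ^ 2 * b + ω * c, a + ω * b + ω ^ 2 * c] (y - x)
        else (0 : ℂ)) := by
  obtain ⟨t, ht⟩ : ∃ t : ℂ, 3 * t = 1 := ⟨1 / 3, by norm_num⟩
  refine ⟨![![t, t, t], ![t, t * ω, t * ω ^ 2], ![t, t * ω ^ 2, t * ω]],
    ![![1, 1, 1], ![1, ω, ω ^ 2], ![1, ω ^ 2, ω]],
    ![![1, 1, 1], ![1, ω, ω ^ 2], ![1, ω ^ 2, ω]], fun p q r => ?_⟩
  fin_cases p <;> fin_cases q <;> fin_cases r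
  all_goals simp (config := { decide := true }) [Fin.sum_univ_three]
  all_goals grind

/-- `u(a+b+c, a+ω²b+ωc, a+ωb+ω²c) ≥ u(a,b,c)`: the matrices are `s·DFT', DFT', DFT'` with
`DFT' = (ω^{-jk})` and `9s = 1`. -/
theorem restricts_fourier_inv (ω a b c : ℂ) (hω : ω ^ 2 + ω + 1 = 0) :
    TensorRestrictsTo
      (fun x y z : Fin 3 =>
        if x + y + z = 0 then
          ![a + b + c, a + ω ^ 2 * b + ω * c, a + ω * b + ω ^ 2 * c] (y - x)
        else (0 : ℂ))
      (fun x y z : Fin 3 => if x + y + z = 0 then ![a, b, c] (y - x) else (0 : ℂ)) := by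
  obtain ⟨s, hs⟩ : ∃ s : ℂ, 9 * s = 1 := ⟨1 / 9, by norm_num⟩
  refine ⟨![![s, s, s], ![s, s * ω ^ 2, s * ω], ![s, s * ω, s * ω ^ 2]],
    ![![1, 1, 1], ![1, ω ^ 2, ω], ![1, ω, ω ^ 2]],
    ![![1, 1, 1], ![1, ω ^ 2, ω], ![1, ω, ω ^ 2]], fun p q r => ?_⟩
  fin_cases p <;> fin_cases q <;> fin_cases r
  all_goals simp (config := { decide := true }) [Fin.sum_univ_three]
  all_goals grind

end HessianPlaneWeyl

open HessianPlaneWeyl in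
/-- **Support item `WeylSymmetry` of route HessianPlane** (stmt-MatrixMultiplication-4896): for
`ω² + ω + 1 = 0`, all `(a,b,c) ∈ ℂ³` and all `N`, the rank of the `N`-th Kronecker power of the
Hessian-plane tensor `u(a,b,c)` is unchanged under the five Weyl-group generators
`C (a,b,c) ↦ (b,c,a)`, `S ↦ (a,c,b)`, `D ↦ (a,ωb,ω²c)`, `D′ ↦ (a,ωb,ωc)` and the Fourier element
`F ↦ (a+b+c, a+ω²b+ωc, a+ωb+ω²c)` — each being a pair of mutually inverse restrictions. -/
theorem weylSymmetry_proof :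
    Summit.MatrixMultiplication.MatrixMultiplication.Theses.HessianPlane.WeylSymmetry := by
  unfold Summit.MatrixMultiplication.MatrixMultiplication.Theses.HessianPlane.WeylSymmetry
  intro ω hω a b c N
  refine ⟨?_, ?_, ?_, ?_, ?_⟩
  · exact tensorRank_kroneckerPow_eq_of_restricts (restricts_cyclic a b c)
      ((restricts_cyclic b c a).trans (restricts_cyclic c a b)) N
  · exact tensorRank_kroneckerPow_eq_of_restricts (restricts_swap a b c) (restricts_swap a c b) N
  · exact tensorRank_kroneckerPow_eq_of_restricts (restricts_charD ω a b c hω)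
      (restricts_charD_inv ω a b c hω) N
  · exact tensorRank_kroneckerPow_eq_of_restricts (restricts_charD' ω a b c hω)
      (restricts_charD'_inv ω a b c hω) N
  · exact tensorRank_kroneckerPow_eq_of_restricts (restricts_fourier ω a b c hω)
      (restricts_fourier_inv ω a b c hω) N

end Summit.MatrixMultiplication.MatrixMultiplication.Theorems

end
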